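import Literature.MathematicalPhysics.QuantumFieldTheory.Balaban1983to89.Node00.BgLettersPrOfRecord
import Literature.MathematicalPhysics.QuantumFieldTheory.Balaban1983to89.B11Eq90V0GroupComposed
import HarnessLib

/-!
# N07 — THE LOG-DEFECT BRIDGE AND (48) AT def-Y's FRAMED LETTERS (`…Pr` RE-PRESS of ✓p828374 §1 ∕ ✓p828600 §1–§3 behind (A2) ✓p829103 `Node00/BgAveragingPrOfRecord` and (A3)
# `Node00/BgLettersPrOfRecord`): T-Q^{pr} (`Q^{pr}` read on the functions IS `qPrCplxOp ∘ evLit`), `Q^{pr}A′ + C^{pr}(A′) = (1∕i)·mlog(Ū^{pr}(expOver U₀ (η•evLit A′))·(Ū^kU₀)⋆)`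
# (the body of `CprOfRecord`), both directions of «`Ū^{pr}(chart field) = ↑V` ⟺ `Q^{pr}A′ + C^{pr}A′ = B(V)`», and (48) for the framed Sect. C pair `(H₁^{pr}, C^{sl,pr})`

Cell `pub-ymgap`, width seat `pub-ymgap-dag-n07-w3` (g28), INTENT-6 ∕ CLAIM-6.  `--kind proof --supports stmt-QuantumFields-27238 --as helper`; count-neutral.  NEW basename `…Pr` per ★★★ №608 (2)
(frame-free companions ✓`…N07Eq48AtRecord` ∕ ✓`…N07ConstraintLogBridge` stay landed, USE-HELD on the k-uniform road).  [15] = [Balaban1985Variational]; [B9] = [Balaban1985BackgroundPropagators].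

WHAT (kernel, sorry-free, standard axioms; any `N`, any background `U₀`, ANY frame datum `𝔥 : FrameDatum (F.P K) N k U₀`; `Q^{pr} A′ := readFun (phiRec N) _ (wBRec F K k) (QprOfRecord F N k U₀ 𝔥) (JetSup.equiv … A′)`).
* §1 ★★ `readFun_QprOfRecord_jet_eq_qPrCplxOp` (T-Q^{pr}): `Q^{pr} A′ = qPrCplxOp k U₀ 𝔥 (evLit A′)` (✓`QprOfRecord := bondFieldOut ∘ qPrCplxOp ∘ bondFieldIn`; carriers cancel; `rfl`-grade).
* §2 ★★ `readFun_Qpr_add_Cpr_apply` — THE FRAMED BRIDGE: `(Q^{pr}A′)(c) + C^{pr}(A′)(c) = (1∕i)·mlog(avPrM 𝔥 (expOver U₀ (η•evLit A′))(c)·(Ū^kU₀)(c)⋆)` (body of ✓`CprOfRecord`).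
* §3 ★★ `Qpr_add_Cpr_eq_B_of_avPrM_eq` (⟹, no smallness) ∕ ★★ `avPrM_eq_of_Qpr_add_Cpr_eq_B` (⟸ on the log-disc, ✓`MatrixLog.exp_mlog` + unitarity of `Ū^kU₀`):
  «`avPrM 𝔥 (expOver U₀ (η•evLit A′)) = ↑V` ⟺ `Q^{pr}A′ + C^{pr}(A′) = B(V)`» (`B = BOfRecord`, unchanged by the frame since `𝔥.map_bg = 1`).
* §4 ★★ `readFun_Qpr_T47_add_cslPr` — **(48) FOR THE FRAMED SECT. C PAIR**: under lit's `Regime (H1prOfRecordAtBg … 𝔥 levB a hpos hQ) 0 (CslprOfRecord … 𝔥 levB) b 0 C₂ c₄ 0 a_C ε_C` and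
  `‖A′‖ < a_C`: `Q^{pr}(T47 A′) + C^{sl,pr}(T47 A′) = Q^{pr} A′` (✓`T47_sub_self` + (45) ✓`Q_H1LatticeCLM` at the framed pair `(Q^{pr}, Q′)`); `readFun_Qpr_T47_of_eq` (`Q^{pr}A′ = B ⟹ … = B`);
  `CslprOfRecord_of_trace_eq_zero` (`C^{sl,pr} = C^{pr}` on traceless jets); ★★★ `avPrM_T47_eq_of_logDisc` — the FRAMED CHART's average clause: `Q^{pr}A′ = B(V)`, the regime, `T47 A′` traceless and
  the two log-disc rows ⟹ `avPrM 𝔥 (expOver U₀ (η•evLit (T47 A′))) = ↑V` — what a `T47`-chart over `Ū^{pr}` needs for the KNIT token (rng)'s average conjunct.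
* §5 (v1.1) ★★ THE FRAME FLAG: `iterMh_eq_frameConj_of_avPrM_eq` ∕ `coe_iter_eq_frameConj_of_avPrM_eq` — the framed constraint `avPrM 𝔥 W = ↑V` says `Ū^k(W) = h(W)⁻¹·V·h(W)` (the inverse-frame
  conjugate), NOT the K0ᴬ road's displayed `Ū^k(W) = V` unless the frame drops out; `iter_eq_of_avPrM_frameless_eq` — over the frameless datum it IS the display verbatim.

HONEST LABELS.  Definitional unfoldings + one `exp∘mlog = id`; the Sect. C regime of the FRAMED pair, `hpos`∕`hQ` of the framed triple ([B9] Thm 3.11 for `(Q^{pr}, Q′)`, `Q^{pr}` onto —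
✓`…N07QprOfRecordOnto` gives the latter from (V1)), tracelessness and the log-disc rows are DISPLAYED; for the frameless datum every statement IS its frame-free companion (vacuity guard of (A2)); nothing of
Bałaban's estimates; K0ᴬ ⟨27238⟩ NOT closed; N07 NOT discharged; R4 is the conditional finite-𝕋⁴ rung `BalabanLadder.UV` only; finite torus, fixed `ε` — nothing continuum ∕ OS ∕ Clay.
**The Yang–Mills mass gap is NOT proved by any of this.**  No `sorry`, no `def`, no `instance ∕ notation`; standard axioms.
-/

set_option autoImplicit false

noncomputable section

open scoped Matrix Matrix.Norms.L2Operator InnerProductSpace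

namespace Summit.QuantumFields.YangMills.Theorems.N07ConstraintLogBridgePr

open Literature.MathematicalPhysics.QuantumFieldTheory.Balaban1983to89
open Literature.MathematicalPhysics.QuantumFieldTheory.Balaban1983to89.T4Continuum (T4Family)
open Literature.MathematicalPhysics.QuantumFieldTheory.Balaban1983to89.Node00
open NormedSpace (exp)
open MatrixLog (mlog exp_mlog)
open B11Eq103H1Complex (SiteL2K BondL2K readFun readFun_apply funEquiv funEquiv_apply funEquiv_symm_apply Q_H1LatticeCLM)
open B11Eq111FrakG (nabla115 jetLinearEquiv jetLinearEquiv_apply)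
open B11Eq115Space (NegSize NegSup levWeight JetSup)
open B11Eq174Chart (Regime)
open B11Eq90V0GroupComposed (T47 T47_sub_self)

section Record

variable (F : T4Family) (N : ℕ) [NeZero N] (K : ℕ) (k : ℕ) (Ω : ℕ → Set (Site (F.P K) 0)) (U₀ : GaugeField (F.P K) 0 (SU N))
  [Fact (0 < (F.L : ℝ))] [Fact (0 < (F.P K).eta k)] [Fact (0 < c0Rec F K k)] [Fact (∀ c, 0 < wBRec F K k c)]
  (𝔥 : FrameDatum (F.P K) N k U₀) (levB : PBond (F.P K) k → ℕ)

/-! ## §1  T-Q^{pr} -/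

omit [NeZero N] [Fact (0 < (F.L : ℝ))] [Fact (0 < (F.P K).eta k)] [Fact (0 < c0Rec F K k)] [Fact (∀ c, 0 < wBRec F K k c)] in
/-- ★★ **T-Q^{pr}**: the framed `Q^{pr}(U₀)` read on the functions along the jet presentation IS `qPrCplxOp k U₀ 𝔥` on `evLit A′` (the carrier maps cancel).
[cite: Balaban1985BackgroundPropagators, (3.13)–(3.16) p.393, (3.113) p.418; Balaban1985Variational, (44) p.285, (19) p.281] -/
theorem readFun_QprOfRecord_jet_eq_qPrCplxOp (A : Space115Lit F N K k Ω U₀) :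
    readFun (phiRec N) _ (wBRec F K k) (QprOfRecord F N k U₀ 𝔥) (JetSup.equiv _ _ (nabla115 ((F.P K).eta k) (unitsOfRecord F N U₀)) A) =
      qPrCplxOp k U₀ 𝔥 (evLit F N K k Ω U₀ A) := by
  funext c
  rw [readFun_apply, funEquiv_apply, QprOfRecord_apply, LinearEquiv.apply_symm_apply]
  rfl

/-! ## §2  The framed bridge identity -/

omit [Fact (0 < (F.L : ℝ))] [Fact (0 < (F.P K).eta k)] [Fact (0 < c0Rec F K k)] [Fact (∀ c, 0 < wBRec F K k c)] in
/-- ★★ **THE FRAMED LOG-DEFECT BRIDGE** (the body of ✓`CprOfRecord`): `(Q^{pr}A′)(c) + C^{pr}(A′)(c) = (1∕i)·mlog( Ū^{pr}_h(expOver U₀ (η_k•evLit A′))(c) · (Ū^kU₀)(c)⋆ )`.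
[cite: Balaban1985Variational, (44) p.285, (20) p.281; Balaban1985Averaging, (92) p.31; Balaban1985BackgroundPropagators, (3.113) p.418] -/
theorem readFun_Qpr_add_Cpr_apply (A : Space115Lit F N K k Ω U₀) (c : PBond (F.P K) k) :
    readFun (phiRec N) _ (wBRec F K k) (QprOfRecord F N k U₀ 𝔥) (JetSup.equiv _ _ (nabla115 ((F.P K).eta k) (unitsOfRecord F N U₀)) A) c +
        NegSup.equiv _ _ (CprOfRecord F N K k Ω U₀ 𝔥 levB A) c =
      (Complex.I⁻¹ : ℂ) • mlog (avPrM 𝔥 (expOver U₀ ((((F.P K).eta k : ℝ) : ℂ) • evLit F N K k Ω U₀ A)) c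
          * star (Averaging.iter (avOfRecord F N K) k U₀ c : Matrix (Fin N) (Fin N) ℂ)) := by
  rw [CprOfRecord_apply, readFun_QprOfRecord_jet_eq_qPrCplxOp]
  abel

/-! ## §3  «`Ū^{pr}(chart field) = V` ⟺ `Q^{pr}A′ + C^{pr}(A′) = B(V)`» (⟸ on the log-disc) -/

omit [Fact (0 < (F.L : ℝ))] [Fact (0 < (F.P K).eta k)] [Fact (0 < c0Rec F K k)] [Fact (∀ c, 0 < wBRec F K k c)] in
/-- ★★ **(⟹)** `avPrM 𝔥 (expOver U₀ (η•evLit A′)) = ↑V ⟹ Q^{pr}A′ + C^{pr}(A′) = B(V)` (both sides the same logarithm; no smallness).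
[cite: Balaban1985Variational, (20) p.281, (44) p.285; Balaban1985Averaging, (92) p.31] -/
theorem Qpr_add_Cpr_eq_B_of_avPrM_eq (A : Space115Lit F N K k Ω U₀) {V : GaugeField (F.P K) k (SU N)}
    (h : avPrM 𝔥 (expOver U₀ ((((F.P K).eta k : ℝ) : ℂ) • evLit F N K k Ω U₀ A)) = coeField V) :
    readFun (phiRec N) _ (wBRec F K k) (QprOfRecord F N k U₀ 𝔥) (JetSup.equiv _ _ (nabla115 ((F.P K).eta k) (unitsOfRecord F N U₀)) A) +
        NegSup.equiv _ _ (CprOfRecord F N K k Ω U₀ 𝔥 levB A) =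
      NegSup.equiv _ _ (BOfRecord F N K k U₀ levB V) := by
  funext c
  rw [Pi.add_apply, readFun_Qpr_add_Cpr_apply, h, coeField_apply, BOfRecord_apply]

omit [Fact (0 < (F.L : ℝ))] [Fact (0 < (F.P K).eta k)] [Fact (0 < c0Rec F K k)] [Fact (∀ c, 0 < wBRec F K k c)] in
/-- ★★ **(⟸) ON THE LOG-DISC**: `Q^{pr}A′ + C^{pr}(A′) = B(V)` with both relative units within `‖· − 1‖ < 1` ⟹ `avPrM 𝔥 (expOver U₀ (η•evLit A′)) = ↑V`.
[cite: Balaban1985Variational, (20) p.281, (44) p.285; Balaban1985Averaging, (21) p.21, (92) p.31] -/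
theorem avPrM_eq_of_Qpr_add_Cpr_eq_B (A : Space115Lit F N K k Ω U₀) {V : GaugeField (F.P K) k (SU N)}
    (h : readFun (phiRec N) _ (wBRec F K k) (QprOfRecord F N k U₀ 𝔥) (JetSup.equiv _ _ (nabla115 ((F.P K).eta k) (unitsOfRecord F N U₀)) A) +
        NegSup.equiv _ _ (CprOfRecord F N K k Ω U₀ 𝔥 levB A) =
      NegSup.equiv _ _ (BOfRecord F N K k U₀ levB V))
    (hdiscA : ∀ c, ‖avPrM 𝔥 (expOver U₀ ((((F.P K).eta k : ℝ) : ℂ) • evLit F N K k Ω U₀ A)) c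
        * star (Averaging.iter (avOfRecord F N K) k U₀ c : Matrix (Fin N) (Fin N) ℂ) - 1‖ < 1)
    (hdiscV : ∀ c, ‖(V c : Matrix (Fin N) (Fin N) ℂ) * star (Averaging.iter (avOfRecord F N K) k U₀ c : Matrix (Fin N) (Fin N) ℂ) - 1‖ < 1) :
    avPrM 𝔥 (expOver U₀ ((((F.P K).eta k : ℝ) : ℂ) • evLit F N K k Ω U₀ A)) = coeField V := by
  funext c
  have hc := congrFun h c
  rw [Pi.add_apply, readFun_Qpr_add_Cpr_apply, BOfRecord_apply] at hc
  have hI : (Complex.I⁻¹ : ℂ) ≠ 0 := inv_ne_zero Complex.I_ne_zero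
  have hlog := smul_right_injective (Matrix (Fin N) (Fin N) ℂ) hI hc
  have hexp := congrArg exp hlog
  rw [exp_mlog (hdiscA c), exp_mlog (hdiscV c)] at hexp
  set W : Matrix (Fin N) (Fin N) ℂ := (Averaging.iter (avOfRecord F N K) k U₀ c : Matrix (Fin N) (Fin N) ℂ) with hW
  have hWW : star W * W = 1 := Matrix.mem_unitaryGroup_iff'.mp (Matrix.mem_specialUnitaryGroup_iff.mp (Averaging.iter (avOfRecord F N K) k U₀ c).2).1
  have e := congrArg (fun M : Matrix (Fin N) (Fin N) ℂ => M * W) hexp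
  simp only [mul_assoc, hWW, mul_one] at e
  rw [coeField_apply]
  exact e

/-! ## §4  (48) for the framed Sect. C pair and the framed chart's average clause -/

section SectC

variable (a : ℝ)
  (hpos : ∀ x, x ≠ 0 → 0 < RCLike.re ⟪x, laplaceAOfRecord F N k U₀ (QprOfRecord F N k U₀ 𝔥) (QprimeOfRecord F N k U₀) a x⟫_ℂ)
  (hQ : Function.Surjective (QprOfRecord F N k U₀ 𝔥))

/-- ★★ **[15] (48) FOR THE FRAMED SECT. C PAIR `(H₁^{pr}, C^{sl,pr})`**: under its Sect. C regime and `‖A′‖ < a_C`, `Q^{pr}(T47 A′) + C^{sl,pr}(T47 A′) = Q^{pr} A′` read on the functions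
(lit ✓`T47_sub_self` ((49)) + (45) `Q^{pr} H₁^{pr} = 1` (✓`Q_H1LatticeCLM` at the pair `(Q^{pr}, Q′)`) + linearity).
[cite: Balaban1985Variational, (48) p.285, (45) p.285, (47)–(49) p.285; Balaban1985BackgroundPropagators, (3.113) p.418] -/
theorem readFun_Qpr_T47_add_cslPr {b C₂ c₄ aC εC : ℝ}
    (RC : Regime (H1prOfRecordAtBg F N K k Ω U₀ 𝔥 levB a hpos hQ) (0 : Space115Lit F N K k Ω U₀ →L[ℂ] Space115Lit F N K k Ω U₀)
      (CslprOfRecord F N K k Ω U₀ 𝔥 levB) b 0 C₂ c₄ 0 aC εC)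
    {A' : Space115Lit F N K k Ω U₀} (hA' : ‖A'‖ < aC) :
    readFun (phiRec N) _ (wBRec F K k) (QprOfRecord F N k U₀ 𝔥)
        (JetSup.equiv _ _ (nabla115 ((F.P K).eta k) (unitsOfRecord F N U₀))
          (T47 (H1prOfRecordAtBg F N K k Ω U₀ 𝔥 levB a hpos hQ) (CslprOfRecord F N K k Ω U₀ 𝔥 levB) εC A')) +
      NegSup.equiv _ _ (CslprOfRecord F N K k Ω U₀ 𝔥 levB
        (T47 (H1prOfRecordAtBg F N K k Ω U₀ 𝔥 levB a hpos hQ) (CslprOfRecord F N K k Ω U₀ 𝔥 levB) εC A')) =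
    readFun (phiRec N) _ (wBRec F K k) (QprOfRecord F N k U₀ 𝔥) (JetSup.equiv _ _ (nabla115 ((F.P K).eta k) (unitsOfRecord F N U₀)) A') := by
  set H := H1prOfRecordAtBg F N K k Ω U₀ 𝔥 levB a hpos hQ with hH
  set C := CslprOfRecord F N K k Ω U₀ 𝔥 levB with hC
  set Y := T47 H C εC A' with hY
  have h49 : Y - A' = -H (C Y) := T47_sub_self RC hA'
  have hY' : A' - H (C Y) = Y := by
    have : A' + (Y - A') = Y := by abel
    rw [h49, ← sub_eq_add_neg] at this
    exact this
  have eJ : JetSup.equiv _ _ (nabla115 ((F.P K).eta k) (unitsOfRecord F N U₀)) (A' - H (C Y)) =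
      JetSup.equiv _ _ (nabla115 ((F.P K).eta k) (unitsOfRecord F N U₀)) A' -
        JetSup.equiv _ _ (nabla115 ((F.P K).eta k) (unitsOfRecord F N U₀)) (H (C Y)) := by
    have e := map_sub (jetLinearEquiv (F.L : ℝ) ((F.P K).eta k) (bondLevLit F Ω k) (pairLevLit F Ω k) (nabla115 ((F.P K).eta k) (unitsOfRecord F N U₀)))
      A' (H (C Y))
    simpa only [jetLinearEquiv_apply] using e
  have h45 : readFun (phiRec N) _ (wBRec F K k) (QprOfRecord F N k U₀ 𝔥)
      (JetSup.equiv _ _ (nabla115 ((F.P K).eta k) (unitsOfRecord F N U₀)) (H (C Y))) = NegSup.equiv _ _ (C Y) :=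
    Q_H1LatticeCLM (phiRec N) hpos hQ _ _ (C Y)
  calc readFun (phiRec N) _ (wBRec F K k) (QprOfRecord F N k U₀ 𝔥) (JetSup.equiv _ _ (nabla115 ((F.P K).eta k) (unitsOfRecord F N U₀)) Y) +
        NegSup.equiv _ _ (C Y)
      = readFun (phiRec N) _ (wBRec F K k) (QprOfRecord F N k U₀ 𝔥) (JetSup.equiv _ _ (nabla115 ((F.P K).eta k) (unitsOfRecord F N U₀)) (A' - H (C Y))) +
          NegSup.equiv _ _ (C Y) := by rw [hY']
    _ = readFun (phiRec N) _ (wBRec F K k) (QprOfRecord F N k U₀ 𝔥) (JetSup.equiv _ _ (nabla115 ((F.P K).eta k) (unitsOfRecord F N U₀)) A') -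
          NegSup.equiv _ _ (C Y) + NegSup.equiv _ _ (C Y) := by rw [eJ, map_sub, h45]
    _ = readFun (phiRec N) _ (wBRec F K k) (QprOfRecord F N k U₀ 𝔥) (JetSup.equiv _ _ (nabla115 ((F.P K).eta k) (unitsOfRecord F N U₀)) A') :=
          sub_add_cancel _ _

/-- **(48) read with a constraint value**: `Q^{pr}A′ = B ⟹ Q^{pr}(T47 A′) + C^{sl,pr}(T47 A′) = B`. [cite: Balaban1985Variational, (48) p.285, (75) p.289, (20) p.281] -/
theorem readFun_Qpr_T47_of_eq {b C₂ c₄ aC εC : ℝ}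
    (RC : Regime (H1prOfRecordAtBg F N K k Ω U₀ 𝔥 levB a hpos hQ) (0 : Space115Lit F N K k Ω U₀ →L[ℂ] Space115Lit F N K k Ω U₀)
      (CslprOfRecord F N K k Ω U₀ 𝔥 levB) b 0 C₂ c₄ 0 aC εC)
    {A' : Space115Lit F N K k Ω U₀} (hA' : ‖A'‖ < aC) {B : PBond (F.P K) k → Matrix (Fin N) (Fin N) ℂ}
    (hB : readFun (phiRec N) _ (wBRec F K k) (QprOfRecord F N k U₀ 𝔥) (JetSup.equiv _ _ (nabla115 ((F.P K).eta k) (unitsOfRecord F N U₀)) A') = B) :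
    readFun (phiRec N) _ (wBRec F K k) (QprOfRecord F N k U₀ 𝔥)
        (JetSup.equiv _ _ (nabla115 ((F.P K).eta k) (unitsOfRecord F N U₀))
          (T47 (H1prOfRecordAtBg F N K k Ω U₀ 𝔥 levB a hpos hQ) (CslprOfRecord F N K k Ω U₀ 𝔥 levB) εC A')) +
      NegSup.equiv _ _ (CslprOfRecord F N K k Ω U₀ 𝔥 levB
        (T47 (H1prOfRecordAtBg F N K k Ω U₀ 𝔥 levB a hpos hQ) (CslprOfRecord F N K k Ω U₀ 𝔥 levB) εC A')) = B := by
  rw [readFun_Qpr_T47_add_cslPr F N K k Ω U₀ 𝔥 levB a hpos hQ RC hA', hB]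

omit [Fact (0 < c0Rec F K k)] [Fact (∀ c, 0 < wBRec F K k c)] in
/-- On traceless jets `C^{sl,pr} = C^{pr}` (the traceless projection is the identity there, ✓`slProjLit_of_trace_eq_zero`). [cite: Balaban1985Variational, (51) p.286, (44) p.285] -/
theorem CslprOfRecord_of_trace_eq_zero {A : Space115Lit F N K k Ω U₀} (hA : ∀ b', (JetSup.equiv _ _ (nabla115 ((F.P K).eta k) (unitsOfRecord F N U₀)) A b').trace = 0) :
    CslprOfRecord F N K k Ω U₀ 𝔥 levB A = CprOfRecord F N K k Ω U₀ 𝔥 levB A := by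
  rw [CslprOfRecord_apply, slProjLit_of_trace_eq_zero F N K k Ω U₀ hA]

/-- ★★★ **THE FRAMED CHART's AVERAGE CLAUSE, on the log-disc**: if `Q^{pr}A′ = B(V)` (the LINEAR constraint of a framed scheme's chart point), the framed Sect. C regime holds with
`‖A′‖ < a_C`, print's field `X := T47 A′` is traceless on the bonds and the two relative units lie in the log-disc, then `Ū^{pr}_h(expOver U₀ (η•evLit X)) = ↑V` — the nonlinear constraint
(20) for `exp(iηX)U₀` under the framed average: the (rng)-average conjunct of a `T47`-chart over `Ū^{pr}`.
[cite: Balaban1985Variational, (20) p.281, (44)–(48) p.285, (51) p.286; Balaban1985Averaging, (92) p.31] -/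
theorem avPrM_T47_eq_of_logDisc {b C₂ c₄ aC εC : ℝ}
    (RC : Regime (H1prOfRecordAtBg F N K k Ω U₀ 𝔥 levB a hpos hQ) (0 : Space115Lit F N K k Ω U₀ →L[ℂ] Space115Lit F N K k Ω U₀)
      (CslprOfRecord F N K k Ω U₀ 𝔥 levB) b 0 C₂ c₄ 0 aC εC)
    {A' : Space115Lit F N K k Ω U₀} (hA' : ‖A'‖ < aC) {V : GaugeField (F.P K) k (SU N)}
    (hB : readFun (phiRec N) _ (wBRec F K k) (QprOfRecord F N k U₀ 𝔥) (JetSup.equiv _ _ (nabla115 ((F.P K).eta k) (unitsOfRecord F N U₀)) A') =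
      NegSup.equiv _ _ (BOfRecord F N K k U₀ levB V))
    (htr : ∀ b', (JetSup.equiv _ _ (nabla115 ((F.P K).eta k) (unitsOfRecord F N U₀))
        (T47 (H1prOfRecordAtBg F N K k Ω U₀ 𝔥 levB a hpos hQ) (CslprOfRecord F N K k Ω U₀ 𝔥 levB) εC A') b').trace = 0)
    (hdiscA : ∀ c, ‖avPrM 𝔥 (expOver U₀ ((((F.P K).eta k : ℝ) : ℂ) • evLit F N K k Ω U₀
        (T47 (H1prOfRecordAtBg F N K k Ω U₀ 𝔥 levB a hpos hQ) (CslprOfRecord F N K k Ω U₀ 𝔥 levB) εC A'))) c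
        * star (Averaging.iter (avOfRecord F N K) k U₀ c : Matrix (Fin N) (Fin N) ℂ) - 1‖ < 1)
    (hdiscV : ∀ c, ‖(V c : Matrix (Fin N) (Fin N) ℂ) * star (Averaging.iter (avOfRecord F N K) k U₀ c : Matrix (Fin N) (Fin N) ℂ) - 1‖ < 1) :
    avPrM 𝔥 (expOver U₀ ((((F.P K).eta k : ℝ) : ℂ) • evLit F N K k Ω U₀
        (T47 (H1prOfRecordAtBg F N K k Ω U₀ 𝔥 levB a hpos hQ) (CslprOfRecord F N K k Ω U₀ 𝔥 levB) εC A'))) = coeField V := by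
  have h48 := readFun_Qpr_T47_of_eq F N K k Ω U₀ 𝔥 levB a hpos hQ RC hA' hB
  rw [CslprOfRecord_of_trace_eq_zero F N K k Ω U₀ 𝔥 levB htr] at h48
  exact avPrM_eq_of_Qpr_add_Cpr_eq_B F N K k Ω U₀ 𝔥 levB _ h48 hdiscA hdiscV

end SectC

/-! ## §5  The frame flag (v1.1): what the FRAMED constraint `avPrM 𝔥 W = ↑V` says about the UN-FRAMED average — the display of the K0ᴬ road's (rng) -/

section FrameFlag

open B15AveragingHolomorphic (iterMh)

omit [NeZero N] [Fact (0 < (F.L : ℝ))] [Fact (0 < (F.P K).eta k)] [Fact (0 < c0Rec F K k)] [Fact (∀ c, 0 < wBRec F K k c)] in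
/-- ★★ **FRAMED CONSTRAINT ⟹ THE UN-FRAMED HOLOMORPHIC AVERAGE IS THE INVERSE-FRAME CONJUGATE OF `V`**: on the frame's window, `avPrM 𝔥 W = ↑V` reads
`Ū^k_h(W)(c) = h(W)⁻¹(c₋) · V(c) · h(W)(c₊)` — `V` gauge-transformed on the `k`-lattice by the inverse frame (`avPrM 𝔥 W c = h(W)(c₋)·Ū^k_h(W)(c)·h(W)⁻¹(c₊)`,
`h·h⁻¹ = 1` on the window).  So the framed constraint equals the K0ᴬ road's displayed un-framed one (`Ū^k(·) = V`) iff the frame drops out on the chart image;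
for the frameless datum it does (`iter_eq_of_avPrM_frameless_eq`).  Print: the framed `k`-th order average is a different averaging operation — `Ū^k` of the
`u(U)`-transformed field ((88), (92)). [cite: Balaban1985Averaging, (88) p.31, (92) p.31; Balaban1985BackgroundPropagators, (3.113) p.418; Balaban1985Variational, (20)–(21) p.281] -/
theorem iterMh_eq_frameConj_of_avPrM_eq {W : PBond (F.P K) 0 → Matrix (Fin N) (Fin N) ℂ} (hW : W ∈ 𝔥.dom) {V : GaugeField (F.P K) k (SU N)}
    (h : avPrM 𝔥 W = coeField V) (c : PBond (F.P K) k) :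
    iterMh k W c = 𝔥.inv W c.src * (V c : Matrix (Fin N) (Fin N) ℂ) * 𝔥.map W c.tgt := by
  have hmi : ∀ y, 𝔥.map W y * 𝔥.inv W y = 1 := fun y => by
    simpa only [Pi.mul_apply, Pi.one_apply] using congrFun (𝔥.map_mul_inv W hW) y
  have him : ∀ y, 𝔥.inv W y * 𝔥.map W y = 1 := fun y => mul_eq_one_comm.1 (hmi y)
  have hc : 𝔥.map W c.src * iterMh k W c * 𝔥.inv W c.tgt = (V c : Matrix (Fin N) (Fin N) ℂ) := by
    have e := congrFun h c
    rwa [avPrM_apply, coeField_apply] at e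
  calc iterMh k W c = (𝔥.inv W c.src * 𝔥.map W c.src) * iterMh k W c * (𝔥.inv W c.tgt * 𝔥.map W c.tgt) := by
        rw [him, him, one_mul, mul_one]
    _ = 𝔥.inv W c.src * (𝔥.map W c.src * iterMh k W c * 𝔥.inv W c.tgt) * 𝔥.map W c.tgt := by simp only [mul_assoc]
    _ = 𝔥.inv W c.src * (V c : Matrix (Fin N) (Fin N) ℂ) * 𝔥.map W c.tgt := by rw [hc]

omit [Fact (0 < (F.L : ℝ))] [Fact (0 < (F.P K).eta k)] [Fact (0 < c0Rec F K k)] [Fact (∀ c, 0 < wBRec F K k c)] in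
/-- ★★ **THE SAME ON THE GROUP-VALUED AVERAGE, UNDER THE GUARD**: for an `SU(N)`-valued `U` passing the small-field guard below `k` (`Ū^k_h(↑U) = ↑(Ū^kU)`) with
`↑U` in the window, the framed constraint `avPrM 𝔥 ↑U = ↑V` gives `↑(Ū^kU)(c) = h(↑U)⁻¹(c₋) · V(c) · h(↑U)(c₊)` — NOT `Ū^kU = V` unless the frame is trivial there.
[cite: Balaban1985Averaging, (92) p.31; Balaban1987RG1, (0.4) p.253, (0.21) p.256; Balaban1985BackgroundPropagators, (3.113) p.418] -/
theorem coe_iter_eq_frameConj_of_avPrM_eq {U : GaugeField (F.P K) 0 (SU N)} (hU : coeField U ∈ 𝔥.dom) (hguard : SmallBelow (avOfRecord F N K) k U)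
    {V : GaugeField (F.P K) k (SU N)} (h : avPrM 𝔥 (coeField U) = coeField V) (c : PBond (F.P K) k) :
    (Averaging.iter (avOfRecord F N K) k U c : Matrix (Fin N) (Fin N) ℂ) = 𝔥.inv (coeField U) c.src * (V c : Matrix (Fin N) (Fin N) ℂ) * 𝔥.map (coeField U) c.tgt := by
  rw [← iterMh_eq_frameConj_of_avPrM_eq F N K k U₀ 𝔥 hU h c, iterMh_coeField_of_smallBelow F N k U hguard, coeField_apply]

omit [Fact (0 < (F.L : ℝ))] [Fact (0 < (F.P K).eta k)] [Fact (0 < c0Rec F K k)] [Fact (∀ c, 0 < wBRec F K k c)] in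
/-- ★★ **OVER THE FRAMELESS DATUM THE FRAMED CONSTRAINT IS (rng)'s DISPLAY VERBATIM**: `avPrM (frameless) ↑U = ↑V` + the guard ⟹ `Ū^kU = V`
(✓`avPrM_frameless = iterMh k`, `Subtype` injectivity) — the instance K0ᴬ-road consumers of the displayed token `Averaging.iter (avOfRecord F N K) k (S.chart V A) = V` cite.
[cite: Balaban1985Averaging, (92) p.31; Balaban1987RG1, (0.21) p.256; Balaban1985Variational, (20) p.281] -/
theorem iter_eq_of_avPrM_frameless_eq {U : GaugeField (F.P K) 0 (SU N)} (hguard : SmallBelow (avOfRecord F N K) k U) {V : GaugeField (F.P K) k (SU N)}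
    (h : avPrM (FrameDatum.frameless k U₀) (coeField U) = coeField V) : Averaging.iter (avOfRecord F N K) k U = V := by
  rw [avPrM_frameless, iterMh_coeField_of_smallBelow F N k U hguard] at h
  funext c
  exact Subtype.ext (by simpa only [coeField_apply] using congrFun h c)

end FrameFlag

end Record

end Summit.QuantumFields.YangMills.Theorems.N07ConstraintLogBridgePr

end
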